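import Mathlib

/-!
# Mode sampling for block-diagonal dynamics — DEQ-A90, Proposition A90 (i) (receipt)

HONEST FRAMING: instance-level adjudication of specific advantage claims; no claim about
BQP vs BPP or the summit.

Source of the CLAIM: Meng–Chen–Liu–He, arXiv:2511.18802v1 (rapidly distorted turbulence by
LCHS): the dynamics matrix is block-diagonal over Fourier modes (eq. (12)), the initial state is
`∑_m A_m |m⟩ ⊗ v_m` with explicit real amplitudes `A_m` (eq. (46)), and the outputs are
block-diagonal quadratic statistics (Reynolds stresses, eqs. (89)–(90)).  DEQ-A90
(pub-qadeq-harvest-1/DEQ-A90.md), Proposition A90 (i): the statistic `⟨U(t)|O|U(t)⟩` is then the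
`A_m²`-weighted AVERAGE of single-mode statistics `z_m = (G_m v_m)† O_m (G_m v_m)`, so drawing
`m ∼ A_m²` and returning `z_m` is an unbiased estimator; for the Reynolds-stress blocks the summand
is bounded by the mode energy `‖G_m v_m‖²`.  This file is the kernel-checked form of those two
elementary facts (the probability bookkeeping of Proposition A90 (ii) is
`Literature/Computability/Complexity/MedianOfMeans.lean`).  Everything is a finite sum over
`Fin N × Fin d`; `y m` stands for the propagated mode vector `G_m(t) v_m`.

* `blockForm_blockState` — `⟨U|O|U⟩ = ∑_m A_m² · z_m` for `U_m = A_m • y_m`, `A_m` real;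
* `sum_weight_modeStat` — the same identity read as an expectation under `p_m := A_m²`;
* `abs_re_mul_conj_le` — `|Re(y_a · conj y_b)| ≤ ∑_c |y_c|²` (the Reynolds-stress summand is
  bounded by the mode energy);
* `blockNormSq_blockState` — `∑_m ‖U_m‖² = ∑_m A_m² ‖y_m‖²` (the energy is the block form of
  the identity).
-/

namespace Summit.QuantumAdvantage.Dequantization.ModeSampling

open Finset
open scoped ComplexConjugate

variable {N d : ℕ}

/-- The state of a mode-decoupled system after propagation: `U_m = A_m • y_m`, `y_m = G_m(t)v_m`
(DEQ-A90 §2; arXiv:2511.18802 eqs. (43), (46)). -/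
def blockState (A : Fin N → ℝ) (y : Fin N → Fin d → ℂ) : Fin N → Fin d → ℂ :=
  fun m a => (A m : ℂ) * y m a

/-- A block-diagonal quadratic form `⟨U|O|U⟩ = ∑_m ∑_{a,b} conj(U_m a) (O_m)_{ab} U_m b`
(arXiv:2511.18802 eq. (89): `R̂_ij = ½ I ⊗ (|j⟩⟨i| + |i⟩⟨j|)` is of this form). -/
def blockForm (O : Fin N → Matrix (Fin d) (Fin d) ℂ) (U : Fin N → Fin d → ℂ) : ℂ :=
  ∑ m, ∑ a, ∑ b, conj (U m a) * O m a b * U m b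

/-- The single-mode statistic `z_m = y_m† O_m y_m` returned by one draw of the mode sampler
(DEQ-A90 eq. (A90.1)). -/
def modeStat (O : Fin N → Matrix (Fin d) (Fin d) ℂ) (y : Fin N → Fin d → ℂ) (m : Fin N) : ℂ :=
  ∑ a, ∑ b, conj (y m a) * O m a b * y m b

/-- **DEQ-A90 (A90.1) / Proposition A90 (i), algebraic half**: for real amplitudes,
`⟨U|O|U⟩ = ∑_m A_m² · z_m`. -/
theorem blockForm_blockState (O : Fin N → Matrix (Fin d) (Fin d) ℂ) (A : Fin N → ℝ)
    (y : Fin N → Fin d → ℂ) :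
    blockForm O (blockState A y) = ∑ m, ((A m : ℂ) ^ 2) * modeStat O y m := by
  unfold blockForm blockState modeStat
  refine Finset.sum_congr rfl fun m _ => ?_
  rw [Finset.mul_sum]
  refine Finset.sum_congr rfl fun a _ => ?_
  rw [Finset.mul_sum]
  refine Finset.sum_congr rfl fun b _ => ?_
  simp only [map_mul, Complex.conj_ofReal]
  ring

/-- **Proposition A90 (i), unbiasedness**: with `p_m := A_m²` (a probability vector when the state
is normalised), `∑_m p_m z_m = ⟨U|O|U⟩` — the mode sampler `m ∼ p`, output `z_m`, is unbiased. -/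
theorem sum_weight_modeStat (O : Fin N → Matrix (Fin d) (Fin d) ℂ) (A : Fin N → ℝ)
    (y : Fin N → Fin d → ℂ) :
    ∑ m, ((A m ^ 2 : ℝ) : ℂ) * modeStat O y m = blockForm O (blockState A y) := by
  rw [blockForm_blockState]
  simp

/-- The total energy is the block form of the identity: `∑_m ‖U_m‖² = ∑_m A_m² ‖y_m‖²`
(normalisation `R_kk(0) = 1` of arXiv:2511.18802 eq. (90) ⇔ `∑_m A_m² = 1` when `‖v_m‖ = 1`). -/
theorem blockNormSq_blockState (A : Fin N → ℝ) (y : Fin N → Fin d → ℂ) :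
    ∑ m, ∑ a, Complex.normSq (blockState A y m a) = ∑ m, A m ^ 2 * ∑ a, Complex.normSq (y m a) := by
  unfold blockState
  refine Finset.sum_congr rfl fun m _ => ?_
  rw [Finset.mul_sum]
  refine Finset.sum_congr rfl fun a _ => ?_
  rw [Complex.normSq_mul, Complex.normSq_ofReal]
  ring

/-- **Proposition A90 (i), range of the Reynolds-stress summand**: for every mode vector `y` and
components `a, b`, `|Re(y_a · conj y_b)| ≤ ∑_c |y_c|²` — the summand of the `R_ab` estimator is
bounded by the mode energy `‖G_m v_m‖²` (hence by `g(t)²`). -/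
theorem abs_re_mul_conj_le (y : Fin d → ℂ) (a b : Fin d) :
    |(y a * conj (y b)).re| ≤ ∑ c, Complex.normSq (y c) := by
  have h1 : |(y a * conj (y b)).re| ≤ ‖y a‖ * ‖y b‖ := by
    calc |(y a * conj (y b)).re| ≤ ‖y a * conj (y b)‖ := Complex.abs_re_le_norm _
      _ = ‖y a‖ * ‖y b‖ := by rw [norm_mul, Complex.norm_conj]
  have h2 : ‖y a‖ * ‖y b‖ ≤ (‖y a‖ ^ 2 + ‖y b‖ ^ 2) / 2 := by
    nlinarith [sq_nonneg (‖y a‖ - ‖y b‖)]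
  have hsq : ∀ c, ‖y c‖ ^ 2 = Complex.normSq (y c) := fun c => Complex.sq_norm _
  have hnn : ∀ c ∈ (univ : Finset (Fin d)), 0 ≤ Complex.normSq (y c) :=
    fun c _ => Complex.normSq_nonneg _
  rcases eq_or_ne a b with hab | hab
  · subst hab
    have hle : Complex.normSq (y a) ≤ ∑ c, Complex.normSq (y c) :=
      Finset.single_le_sum hnn (Finset.mem_univ a)
    calc |(y a * conj (y a)).re| ≤ ‖y a‖ * ‖y a‖ := h1
      _ = Complex.normSq (y a) := by rw [← sq, hsq]
      _ ≤ ∑ c, Complex.normSq (y c) := hle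
  · have hle : Complex.normSq (y a) + Complex.normSq (y b) ≤ ∑ c, Complex.normSq (y c) := by
      have hpair := Finset.sum_pair (f := fun c => Complex.normSq (y c)) hab
      rw [← hpair]
      exact Finset.sum_le_sum_of_subset_of_nonneg (Finset.subset_univ _) fun c _ _ =>
        Complex.normSq_nonneg _
    calc |(y a * conj (y b)).re| ≤ ‖y a‖ * ‖y b‖ := h1
      _ ≤ (‖y a‖ ^ 2 + ‖y b‖ ^ 2) / 2 := h2
      _ ≤ ‖y a‖ ^ 2 + ‖y b‖ ^ 2 := by nlinarith [sq_nonneg ‖y a‖, sq_nonneg ‖y b‖]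
      _ = Complex.normSq (y a) + Complex.normSq (y b) := by rw [hsq, hsq]
      _ ≤ ∑ c, Complex.normSq (y c) := hle

end Summit.QuantumAdvantage.Dequantization.ModeSampling
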